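import Summits.Ventures.Crystal3D.Theorems.StickyWulffConstantTextureBuildSingleGrainCover
import HarnessLib

/-!
# TB-cover, BASE CASE (part 2): the v7 MESH of the single-grain cover — every field of `Mesh₃ … Mesh₇` discharged, ZERO slack
# (lane T, crux `TextureLiminfV5`, stmt-Ventures-23912; registered stub `stub_TB_cover` of `TexShadow` v8.23)

HONEST FRAMING. Venture `Summits/Ventures/Crystal3D` (cell `crystal3d-full`), route `route-Ventures-StickyWulffConstant`, helper `--supports` the
law-v5 crux `TextureLiminfV5` (stmt-Ventures-23912).  Pure proof over '…TextureBuildSingleGrainCover' (census-free, standard axioms).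

**`exists_singleGrain_cover_mesh`**: a unit packing `x` all of whose balls lie on ONE moved Barlow stacking `S = stacking L s σ`, with a ball `x i₀` whose
`S`-sites within `3` are balls (the fiat-solid core sits there) and with at least `(1 − δ)N` balls all of whose `S`-sites within `2√2` are balls (the mass
count), admits the risered cover `singleGrainCover C R₀ …` AND a `Mesh₇` of it with `tilingLoss₂ + rimSum + gapCost ≤ 0` — for ALL constants `C, R₀`.
The mesh: ONE territory polytope (the big box `bigBox x`, frontier EMPTY: every ball is `≥ 3` inside), ONE core polytope (`coreBox (x i₀)`, collar solid by
the choice of `i₀`), no prisms / gap pieces / riser boxes, no designated facet (`gapArea = 0`); the mass clauses `hmass` / `hmass₆` are the supplied count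
(the `√2`-ball of a ball lies in the territory).  Consequence `exists_singleGrain_cover_mesh_slack`: the conclusion of `stub_TB_cover` VERBATIM
(`… ≤ θ·N^{2/3} + unownedSlack₃`, any `θ ≥ 0`) for such packings.  The asymptotic wrapper (solid ball and mass count from `6N − b ≤ K N^{2/3}`) is the sequel.
WHAT THIS IS NOT: no multi-grain cover; F-C1 not moved.
-/

noncomputable section

open scoped BigOperators InnerProductSpace
open MeasureTheory

namespace Summit.Ventures.Crystal3D.Cruxes.TextureLiminf.TexShadow

open Summit.Ventures.Crystal3D Summit.Ventures.Crystal3D.Theorems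
open Literature.MathematicalPhysics.StatisticalMechanics (IsHaggSeq)

section SingleGrainMesh

variable {N : ℕ} {x : Fin N → E3} {L : E3 ≃ₗᵢ[ℝ] E3} {s : E3} {σ : ℤ → ℤ}

/-- **COLLAR SOLIDITY**: if every `S`-site within `3` of the ball `x i₀` is a ball, then every point within `1` of the core box of `x i₀` is SOLID (all
`S`-sites within `√2` of it are balls). -/
theorem solidAt_of_near_core {i₀ : Fin N} (hS3 : ∀ b ∈ stacking L s σ, dist (x i₀) b < 3 → b ∈ Set.range x) {z : E3}
    (hz : Metric.infDist z (⋃ _j : Fin 1, polytope (coreBox (x i₀))) < 1) :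
    ∀ b ∈ stacking L s σ, dist z b ≤ Real.sqrt 2 → b ∈ Finset.univ.image x := by
  intro b hb hzb
  have hne : (⋃ _j : Fin 1, polytope (coreBox (x i₀))).Nonempty := ⟨x i₀, Set.mem_iUnion.2 ⟨0, mem_polytope_coreBox _⟩⟩
  obtain ⟨y, hy, hzy⟩ := (Metric.infDist_lt_iff hne).1 hz
  rw [Set.iUnion_const] at hy
  have hyc : dist y (x i₀) ≤ 1 / 2 := dist_le_half_of_closure_coreBox (subset_closure hy)
  refine mem_image_univ_iff_mem_range.2 (hS3 b hb ?_)
  have h2 : Real.sqrt 2 < 3 / 2 := by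
    rw [show (3 / 2 : ℝ) = Real.sqrt ((3 / 2) ^ 2) by rw [Real.sqrt_sq (by norm_num)]]
    exact Real.sqrt_lt_sqrt (by norm_num) (by norm_num)
  calc dist (x i₀) b ≤ dist (x i₀) y + dist y z + dist z b := dist_triangle4 _ _ _ _
    _ < 3 := by
      rw [dist_comm (x i₀) y, dist_comm y z]
      linarith

/-- **EMPTY FRONTIER**: a frontier point of the territory is `√2`-far from every ball and outside the closed core. -/
theorem emptyAt_of_frontier (i₀ : Fin N) {y : E3} (hy : y ∈ frontier (⋃ _j : Fin 1, polytope (bigBox x))) :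
    (∀ b ∈ Finset.univ.image x, Real.sqrt 2 < dist y b) ∧ y ∉ closure (⋃ _j : Fin 1, polytope (coreBox (x i₀))) := by
  rw [Set.iUnion_const] at hy
  have h2 : Real.sqrt 2 < 3 / 2 := by
    rw [show (3 / 2 : ℝ) = Real.sqrt ((3 / 2) ^ 2) by rw [Real.sqrt_sq (by norm_num)]]
    exact Real.sqrt_lt_sqrt (by norm_num) (by norm_num)
  refine ⟨fun b hb => ?_, ?_⟩
  · rw [Finset.mem_image] at hb
    obtain ⟨i, -, rfl⟩ := hb
    linarith [dist_ge_three_of_frontier_bigBox hy i]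
  · rw [Set.iUnion_const]
    exact not_mem_closure_coreBox_of_frontier hy i₀

/-- The `√2`-ball of a ball lies in the territory. -/
theorem closedBall_subset_bigBox (i : Fin N) : Metric.closedBall (x i) (Real.sqrt 2) ⊆ ⋃ _j : Fin 1, polytope (bigBox x) := by
  intro z hz
  rw [Set.iUnion_const]
  have h2 : Real.sqrt 2 < 3 / 2 := by
    rw [show (3 / 2 : ℝ) = Real.sqrt ((3 / 2) ^ 2) by rw [Real.sqrt_sq (by norm_num)]]
    exact Real.sqrt_lt_sqrt (by norm_num) (by norm_num)
  exact mem_polytope_bigBox_of_dist_lt i (lt_of_le_of_lt (Metric.mem_closedBall.1 hz) (by linarith))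

open scoped Classical in
/-- **THE SINGLE GRAIN ADMITS A RISERED COVER AND A v7 MESH WITH ZERO SLACK.** -/
theorem exists_singleGrain_cover_mesh (C R₀ δ : ℝ) (hx : IsUnitPacking x) (hσ : IsHaggSeq σ) (hS : ∀ i, x i ∈ stacking L s σ) (i₀ : Fin N)
    (hS3 : ∀ b ∈ stacking L s σ, dist (x i₀) b < 3 → b ∈ Set.range x)
    (hmass : (1 - δ) * (N : ℝ) ≤
      ((Finset.univ.filter fun i : Fin N => ∀ b ∈ stacking L s σ, dist (x i) b ≤ 2 * Real.sqrt 2 → b ∈ Set.range x).card : ℝ)) :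
    ∃ (rc : RiseredCover C R₀ N x) (μ : Mesh₇ rc δ), rc.tilingLoss₂ + rc.rimSum + μ.gapCost ≤ 0 := by
  classical
  haveI := singleGrainCover_nk_isEmpty (C := C) (R₀ := R₀) hx hσ hS (x i₀)
  haveI := singleGrainCover_nc_isEmpty (C := C) (R₀ := R₀) hx hσ hS (x i₀)
  haveI := singleGrainCover_nr_isEmpty (C := C) (R₀ := R₀) hx hσ hS (x i₀)
  haveI := singleGrainCover_ng_subsingleton (C := C) (R₀ := R₀) hx hσ hS (x i₀)
  -- the mass count in the mesh's two currencies
  have hcount : ∀ i : Fin N, (∀ b ∈ stacking L s σ, dist (x i) b ≤ 2 * Real.sqrt 2 → b ∈ Set.range x) →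
      (∀ b ∈ stacking L s σ, dist (x i) b ≤ 2 * Real.sqrt 2 → b ∈ Finset.univ.image x ∧ b ∈ Finset.univ.image x) := fun i hi b hb hd =>
    ⟨mem_image_univ_iff_mem_range.2 (hi b hb hd), mem_image_univ_iff_mem_range.2 (hi b hb hd)⟩
  refine ⟨singleGrainCover C R₀ hx hσ hS (x i₀),
    { nD := fun _ => 1
      HD := fun _ _ => bigBox x
      hDbd := fun _ _ => isBounded_polytope_boxH _ _
      hDunit := fun _ _ => boxH_unit _ _
      desD := fun _ _ => ∅
      hdesD := fun _ _ => Finset.empty_subset _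
      nC := fun _ => 1
      HC := fun _ _ => coreBox (x i₀)
      hCbd := fun _ _ => isBounded_polytope_boxH _ _
      hCunit := fun _ _ => boxH_unit _ _
      hCD := fun _ _ => by
        intro y hy
        exact Set.mem_iUnion.2 ⟨0, polytope_coreBox_subset i₀ hy⟩
      HP := fun k => k.elim0
      hPbd := fun k => k.elim0
      hPunit := fun k => k.elim0
      hPZ := fun k => k.elim0
      latP := fun k => k.elim0
      hlatP := fun k => k.elim0
      latArea := fun k => k.elim0
      hlatArea := fun k => k.elim0
      ex := fun k => k.elim0
      hex := fun k => k.elim0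
      hCZ := fun _ _ _ h => by obtain ⟨k, -⟩ := h; exact k.elim0
      hU := fun _ => rfl
      hcollar₃ := fun _ z _ hz => solidAt_of_near_core hS3 hz
      fk := fun k => k.elim0
      gk := fun k => k.elim0
      hfg := fun k => k.elim0
      nQ := 0
      HQ := fun l => l.elim0
      lab := fun l => l.elim0
      HB := fun r => r.elim0
      hBbd := fun r => r.elim0
      hBunit := fun r => r.elim0
      desB := fun r => r.elim0
      hdesB := fun r => r.elim0
      hbdry := fun _ y hy => Or.inl (emptyAt_of_frontier i₀ hy)
      hS₁ := fun k => k.elim0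
      hS₂ := fun k => k.elim0
      hDD := fun f g hfg => absurd (Subsingleton.elim f g) hfg
      hDP := fun _ k => k.elim0
      hPP := fun k => k.elim0
      hside₁ := fun k => k.elim0
      hside₂ := fun k => k.elim0
      hside₀ := fun k => k.elim0
      hagree := fun f g hfg => absurd (Subsingleton.elim f g) hfg
      hwrap₁ := fun k => k.elim0
      hwrap₂ := fun k => k.elim0
      hlaw := fun k => k.elim0
      hQbd := fun l => l.elim0
      hQunit := fun l => l.elim0
      hQD := fun l => l.elim0
      hQP := fun l => l.elim0
      hQQ := fun l => l.elim0
      hBD := fun r => r.elim0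
      hBP := fun r => r.elim0
      hBQ := fun r => r.elim0
      hBB := fun r => r.elim0
      hframe := fun r => r.elim0
      hBclean := fun r => r.elim0
      hBown := fun r => r.elim0
      hBV := fun r => r.elim0
      hBmatch := fun r => r.elim0
      desQ := fun l => l.elim0
      hdesQ := fun l => l.elim0
      hQmatch := fun l => l.elim0
      gapArea := 0
      hgapArea := by simp [Finset.univ_eq_empty]
      hmass := by
        refine le_trans hmass ?_
        exact_mod_cast Finset.card_le_card fun i hi => by
          have hi' := (Finset.mem_filter.1 hi).2
          refine Finset.mem_filter.2 ⟨Finset.mem_univ _, ⟨0, Nat.zero_lt_one⟩, Or.inl fun b hb hd => (hcount i hi' b hb hd).1, ?_⟩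
          intro z hz
          exact Set.mem_union_left _ (Set.mem_union_left _ (closedBall_subset_bigBox i hz))
      hpres₁ := fun k => k.elim0
      hpres₂ := fun k => k.elim0
      hagreeFr := fun f g hfg => absurd (Subsingleton.elim f g) hfg
      hmatchFr := fun f g hfg => absurd (Subsingleton.elim f g) hfg
      hPlat := fun k => k.elim0
      hQmatch₅ := fun l => l.elim0
      hBmatch₅ := fun r => r.elim0
      hBown₅ := fun r => r.elim0
      hBhalo := fun r => r.elim0
      hmass₆ := by
        refine le_trans hmass ?_
        exact_mod_cast Finset.card_le_card fun i hi => by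
          have hi' := (Finset.mem_filter.1 hi).2
          refine Finset.mem_filter.2 ⟨Finset.mem_univ _, ⟨0, Nat.zero_lt_one⟩, Or.inl ⟨hS i, fun b hb hd => hcount i hi' b hb hd⟩, ?_⟩
          intro z hz
          exact Set.mem_union_left _ (Set.mem_union_left _ (closedBall_subset_bigBox i hz))
      hBownRn := fun r => r.elim0 }, ?_⟩
  -- the slack: `0 + 0 + 0 ≤ 0`
  rw [singleGrainCover_tilingLoss₂, singleGrainCover_rimSum]
  simp only [Mesh₇.gapCost, Mesh₆.gapCost, Mesh₅.gapCost, Mesh₄.gapCost, Mesh₃.gapCost]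
  norm_num [Finset.univ_eq_empty]

open scoped Classical in
/-- **THE CONCLUSION OF `stub_TB_cover`, VERBATIM, FOR A SINGLE GRAIN** (any `θ ≥ 0`): `tilingLoss₂ + rimSum + gapCost ≤ θ·N^{2/3} + unownedSlack₃`. -/
theorem exists_singleGrain_cover_mesh_slack (C R₀ δ : ℝ) (hx : IsUnitPacking x) (hσ : IsHaggSeq σ) (hS : ∀ i, x i ∈ stacking L s σ)
    (i₀ : Fin N) (hS3 : ∀ b ∈ stacking L s σ, dist (x i₀) b < 3 → b ∈ Set.range x)
    (hmass : (1 - δ) * (N : ℝ) ≤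
      ((Finset.univ.filter fun i : Fin N => ∀ b ∈ stacking L s σ, dist (x i) b ≤ 2 * Real.sqrt 2 → b ∈ Set.range x).card : ℝ))
    {θ : ℝ} (hθ : 0 ≤ θ) :
    ∃ (rc : RiseredCover C R₀ N x) (μ : Mesh₇ rc δ),
      rc.tilingLoss₂ + rc.rimSum + μ.gapCost ≤ θ * (N : ℝ) ^ ((2 : ℝ) / 3) + rc.unownedSlack₃ := by
  obtain ⟨rc, μ, h⟩ := exists_singleGrain_cover_mesh C R₀ δ hx hσ hS i₀ hS3 hmass
  refine ⟨rc, μ, h.trans ?_⟩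
  have h1 : 0 ≤ θ * (N : ℝ) ^ ((2 : ℝ) / 3) := mul_nonneg hθ (Real.rpow_nonneg (Nat.cast_nonneg N) _)
  have h2 := rc.unownedSlack₃_nonneg
  linarith

end SingleGrainMesh

end Summit.Ventures.Crystal3D.Cruxes.TextureLiminf.TexShadow

end
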